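import Summits.Ventures.PercRepro.C041BlockMapFourCores
import Summits.Ventures.PercRepro.C041BlockMapCoresPure

/-!
# ROW C-041 — TOOLS FOR THE CORES ON FIVE VERTICES: Boolean reachability on five vertices, the colour adjacency, the
tuple bijections of the colourings, the cone / pure forms for two exits at any vertices (p6, gen 37)
-/

namespace PercRepro

namespace ZoneZ

namespace MultiExit

open ZoneData Pendant Finset TwoExit TreeClosure

/-- Boolean reachability in at most `k` steps of a Boolean adjacency on five vertices. -/
def connB5 (adj : Fin 5 → Fin 5 → Bool) : ℕ → Fin 5 → Fin 5 → Bool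
  | 0, s, v => decide (s = v)
  | k + 1, s, v => connB5 adj k s v || (adj s 0 && connB5 adj k 0 v) || (adj s 1 && connB5 adj k 1 v) ||
      (adj s 2 && connB5 adj k 2 v) || (adj s 3 && connB5 adj k 3 v) || (adj s 4 && connB5 adj k 4 v)

/-- The colour-`c` adjacency of a host on five vertices, as a Boolean function. -/
def adjB5 {E U₁ U₂ : Type} [Fintype E] (Z : ZoneData (Fin 5) E U₁ U₂) (c : Bool) (ω : E → Bool)
    (x y : Fin 5) : Bool :=
  decide (∃ e, (Z.fst e = x ∧ Z.snd e = y ∨ Z.fst e = y ∧ Z.snd e = x) ∧ ω e = c)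

/-- The colour adjacency is its Boolean. -/
theorem cAdj_iff_adjB5 {E U₁ U₂ : Type} [Fintype E] (Z : ZoneData (Fin 5) E U₁ U₂) (c : Bool) (ω : E → Bool)
    (x y : Fin 5) : cAdj Z c ω x y ↔ adjB5 Z c ω x y = true := by
  unfold cAdj adjB5 ZoneData.Joins
  rw [decide_eq_true_eq]

/-- An existential over five vertices is the disjunction of its five instances. -/
theorem exists_fin5_iff (P : Fin 5 → Prop) : (∃ t, P t) ↔ P 0 ∨ P 1 ∨ P 2 ∨ P 3 ∨ P 4 := by
  constructor
  · rintro ⟨t, ht⟩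
    fin_cases t
    · exact Or.inl ht
    · exact Or.inr (Or.inl ht)
    · exact Or.inr (Or.inr (Or.inl ht))
    · exact Or.inr (Or.inr (Or.inr (Or.inl ht)))
    · exact Or.inr (Or.inr (Or.inr (Or.inr ht)))
  · rintro (h | h | h | h | h)
    · exact ⟨0, h⟩
    · exact ⟨1, h⟩
    · exact ⟨2, h⟩
    · exact ⟨3, h⟩
    · exact ⟨4, h⟩

/-- Reachability in `≤ k` steps on five vertices is its Boolean. -/
theorem conn_iff_connB5 {E U₁ U₂ : Type} [Fintype E] (Z : ZoneData (Fin 5) E U₁ U₂) (c : Bool) (ω : E → Bool)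
    (k : ℕ) : ∀ (s v : Fin 5), Conn (cAdj Z c ω) k s v ↔ connB5 (adjB5 Z c ω) k s v = true := by
  induction k with
  | zero =>
    intro s v
    simp only [Conn, connB5, decide_eq_true_eq]
  | succ k ih =>
    intro s v
    show (Conn (cAdj Z c ω) k s v ∨ ∃ t, cAdj Z c ω s t ∧ Conn (cAdj Z c ω) k t v) ↔ _
    rw [connB5]
    simp only [Bool.or_eq_true, Bool.and_eq_true, ih, cAdj_iff_adjB5, exists_fin5_iff, or_assoc]

/-- The merged status on five vertices is its Boolean. -/
theorem mg_iff_connB5 {E U₁ U₂ : Type} [Fintype E] (Z : ZoneData (Fin 5) E U₁ U₂) (s v : Fin 5) (ω : E → Bool) :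
    Z.Mg s v ω ↔ connB5 (adjB5 Z false ω) 4 s v = true := by
  rw [Mg_iff_conn Z (k := 4) (by simp), conn_iff_connB5]

/-- The reached status on five vertices is its Boolean. -/
theorem rd_iff_connB5 {E U₁ U₂ : Type} [Fintype E] (Z : ZoneData (Fin 5) E U₁ U₂) (s v : Fin 5) (ω : E → Bool) :
    Z.Rd s v ω ↔ connB5 (adjB5 Z true ω) 4 s v = true := by
  rw [Rd_iff_conn Z (k := 4) (by simp), conn_iff_connB5]

/-- A host with the exits `ex2 x y` whose block map is a given function `θ` of the two inputs is a cone host iff `θ`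
sends pairs of cone members into the cone. -/
theorem coneHost_ex2_iff_of_eq' {W E : Type} [Fintype E] [DecidableEq E] (Z : ZoneData W E Empty Empty) (x y a : W)
    (θ : Vec6 → Vec6 → Vec6) (hθ : ∀ w w', blockMap Z (ex2 x y) a (fun b => if b then w' else w) = θ w w') :
    ConeHost Z (ex2 x y) a ↔ ∀ X Y : Vec6, InCone X → InCone Y → InCone (θ X Y) := by
  constructor
  · intro h X Y hX hY
    have := h _ (inCone_bool_family hX hY)
    rwa [hθ] at this
  · intro h w hw
    rw [bool_family_eq w, hθ]
    exact h _ _ (hw _) (hw _)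

/-- The pure form of the same. -/
theorem coneHost_ex2_iff_pure_of_eq' {W E : Type} [Fintype E] [DecidableEq E] (Z : ZoneData W E Empty Empty)
    (x y a : W) (θ : Vec6 → Vec6 → Vec6)
    (hθ : ∀ w w', blockMap Z (ex2 x y) a (fun b => if b then w' else w) = θ w w') :
    ConeHost Z (ex2 x y) a ↔ ∀ {m m' : ℕ} (a : Fin m → ℝ) (b : Fin m' → ℝ), (∀ i, 0 ≤ a i ∧ a i ≤ 1) →
      (∀ j, 0 ≤ b j ∧ b j ≤ 1) → InCone (θ (V a) (V b)) := by
  rw [coneHost_ex2_iff_pure]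
  simp only [hθ]

/-- A colouring of 7 edges is the vector of its values. -/
theorem fin7_eta (ω : Fin 7 → Bool) : ω = ![ω 0, ω 1, ω 2, ω 3, ω 4, ω 5, ω 6] := by
  funext i
  fin_cases i <;> rfl

/-- The colourings of 7 edges as 7-tuples. -/
def fin7Equiv : (Fin 7 → Bool) ≃ Bool × Bool × Bool × Bool × Bool × Bool × Bool where
  toFun ω := (ω 0, ω 1, ω 2, ω 3, ω 4, ω 5, ω 6)
  invFun p := ![p.1, p.2.1, p.2.2.1, p.2.2.2.1, p.2.2.2.2.1, p.2.2.2.2.2.1, p.2.2.2.2.2.2]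
  left_inv ω := (fin7_eta ω).symm
  right_inv p := by
    obtain ⟨b0, b1, b2, b3, b4, b5, b6⟩ := p
    rfl

/-- The inverse of the 7-tuple bijection. -/
theorem fin7Equiv_symm_apply (b0 b1 b2 b3 b4 b5 b6 : Bool) :
    fin7Equiv.symm (b0, b1, b2, b3, b4, b5, b6) = ![b0, b1, b2, b3, b4, b5, b6] := rfl

/-- A colouring of 8 edges is the vector of its values. -/
theorem fin8_eta (ω : Fin 8 → Bool) : ω = ![ω 0, ω 1, ω 2, ω 3, ω 4, ω 5, ω 6, ω 7] := by
  funext i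
  fin_cases i <;> rfl

/-- The colourings of 8 edges as 8-tuples. -/
def fin8Equiv : (Fin 8 → Bool) ≃ Bool × Bool × Bool × Bool × Bool × Bool × Bool × Bool where
  toFun ω := (ω 0, ω 1, ω 2, ω 3, ω 4, ω 5, ω 6, ω 7)
  invFun p := ![p.1, p.2.1, p.2.2.1, p.2.2.2.1, p.2.2.2.2.1, p.2.2.2.2.2.1, p.2.2.2.2.2.2.1, p.2.2.2.2.2.2.2]
  left_inv ω := (fin8_eta ω).symm
  right_inv p := by
    obtain ⟨b0, b1, b2, b3, b4, b5, b6, b7⟩ := p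
    rfl

/-- The inverse of the 8-tuple bijection. -/
theorem fin8Equiv_symm_apply (b0 b1 b2 b3 b4 b5 b6 b7 : Bool) :
    fin8Equiv.symm (b0, b1, b2, b3, b4, b5, b6, b7) = ![b0, b1, b2, b3, b4, b5, b6, b7] := rfl

/-- A colouring of 9 edges is the vector of its values. -/
theorem fin9_eta (ω : Fin 9 → Bool) : ω = ![ω 0, ω 1, ω 2, ω 3, ω 4, ω 5, ω 6, ω 7, ω 8] := by
  funext i
  fin_cases i <;> rfl

/-- The colourings of 9 edges as 9-tuples. -/
def fin9Equiv : (Fin 9 → Bool) ≃ Bool × Bool × Bool × Bool × Bool × Bool × Bool × Bool × Bool where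
  toFun ω := (ω 0, ω 1, ω 2, ω 3, ω 4, ω 5, ω 6, ω 7, ω 8)
  invFun p := ![p.1, p.2.1, p.2.2.1, p.2.2.2.1, p.2.2.2.2.1, p.2.2.2.2.2.1, p.2.2.2.2.2.2.1, p.2.2.2.2.2.2.2.1, p.2.2.2.2.2.2.2.2]
  left_inv ω := (fin9_eta ω).symm
  right_inv p := by
    obtain ⟨b0, b1, b2, b3, b4, b5, b6, b7, b8⟩ := p
    rfl

/-- The inverse of the 9-tuple bijection. -/
theorem fin9Equiv_symm_apply (b0 b1 b2 b3 b4 b5 b6 b7 b8 : Bool) :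
    fin9Equiv.symm (b0, b1, b2, b3, b4, b5, b6, b7, b8) = ![b0, b1, b2, b3, b4, b5, b6, b7, b8] := rfl

/-- A colouring of 10 edges is the vector of its values. -/
theorem fin10_eta (ω : Fin 10 → Bool) : ω = ![ω 0, ω 1, ω 2, ω 3, ω 4, ω 5, ω 6, ω 7, ω 8, ω 9] := by
  funext i
  fin_cases i <;> rfl

/-- The colourings of 10 edges as 10-tuples. -/
def fin10Equiv : (Fin 10 → Bool) ≃ Bool × Bool × Bool × Bool × Bool × Bool × Bool × Bool × Bool × Bool where
  toFun ω := (ω 0, ω 1, ω 2, ω 3, ω 4, ω 5, ω 6, ω 7, ω 8, ω 9)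
  invFun p := ![p.1, p.2.1, p.2.2.1, p.2.2.2.1, p.2.2.2.2.1, p.2.2.2.2.2.1, p.2.2.2.2.2.2.1, p.2.2.2.2.2.2.2.1, p.2.2.2.2.2.2.2.2.1, p.2.2.2.2.2.2.2.2.2]
  left_inv ω := (fin10_eta ω).symm
  right_inv p := by
    obtain ⟨b0, b1, b2, b3, b4, b5, b6, b7, b8, b9⟩ := p
    rfl

/-- The inverse of the 10-tuple bijection. -/
theorem fin10Equiv_symm_apply (b0 b1 b2 b3 b4 b5 b6 b7 b8 b9 : Bool) :
    fin10Equiv.symm (b0, b1, b2, b3, b4, b5, b6, b7, b8, b9) = ![b0, b1, b2, b3, b4, b5, b6, b7, b8, b9] := rfl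

end MultiExit

end ZoneZ

end PercRepro
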